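/-
Copyright: pub-balaban β-flow team, β-FLOW PROVER 4 (unit `b2b-balaban-beta-bflow-p4`, gen 13; coordinator ruling «YM
ACCELERATION» 2026-08-21 item (2), «work behind the as-printed interface»).  THE COMPLETE AXIAL GAUGE AS AN EXPLICIT SECTION OF THE
LATTICE CURL: for any bond field B on ℤ^d and the path potential Λ_B of PART 23b (axes in increasing order from the corner lo),
B − dΛ_B is the CURTAIN SUM of the curvature, A(x,μ) = −Σ_{k>μ} Σ_{lo_k ≤ t < x_k} F(p_k(x,t), μ, k) — a generalized inverse of the
box curl's incidence matrix with entries in {0, −1}, toward the kernel BOUND of row K-C.  [folklore] lattice Stokes bookkeeping;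
nothing of Bałaban's asserted; NOT N5 for the model, NOT BetaPertH, NOT continuum, NOT Clay.
-/
import Mathlib
import Summits.QuantumFields.BalabanUV.Beta.EriceLatticePoincareBox

/-!
# `Beta.EriceGaugeFormAxial` — PART 26e of the `EriceLoopExpansionD4` series: the complete axial gauge is a curtain sum of the
# curvature (an explicit {0, −1}-valued generalized inverse of the box curl)

Source: T. Bałaban, A. Jaffe, *Constructive gauge theory* (Erice 1985) [BalabanJaffe1986], Part III p. 246 L32–L39 (the axial gauge on □₂,
(3.48)), p. 247 (3.51); T. Bałaban, Commun. Math. Phys. **98** (1985) [Balaban1985Averaging] p. 24 (tree ∕ axial contours); this lineage's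
PART 23b `EriceLatticePoincareBox` (the path potential Λ(x) = Σ_k Σ_{lo_k ≤ t < x_k} B(p_k(x,t), k) integrates a curl-free field; lemmas
`sum_Ico_int_telescope`, `sum_Ico_int_succ`), PART 26a–26c (factorization through ANY generalized inverse S of the incidence matrix; the
kernel entries are D²f(0) on the bond variables σ_q(m) = (b ↦ S_{bq}•m), so a bound on |S_{bq}| is what the kernel BOUND of row K-C needs).

WHAT IS KERNEL-CHECKED HERE (def-free, [folklore]; readings `hp` (the path point p_k(x,t): coordinates below k from x, coordinate k = t,
the rest from lo) and `hΛ` (the path potential)):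
* §1 **`sub_grad_potential_eq_neg_curtain`** — THE CURTAIN IDENTITY: for every B, every x with lo ≤ x and every direction μ,
  B(x,μ) − (Λ(x+e_μ) − Λ(x)) = −Σ_{k>μ} Σ_{t∈[lo_k,x_k)} (B(p,μ) + B(p+e_μ,k) − B(p+e_k,μ) − B(p,k))|_{p = p_k(x,t)} — PART 23b's telescoping
  with the curl terms kept (23b is the case curl = 0).  No box ∕ no finiteness hypothesis beyond lo ≤ x.
* §2 `curl_sub_grad` (the curl of B − dΛ is the curl of B, any Λ), **`curl_curtain_eq_curl`** (hence the curtain field A has the same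
  curl as B on every plaquette z with lo ≤ z: the curtain sum is a SECTION of the curl on fields based at lo), `curtain_plaquette_mem_box`
  (for a bond (x,μ) of the box [lo,hi], every plaquette (p_k(x,t), μ, k), k > μ, lo_k ≤ t < x_k, of its curtain lies in the box).
HONEST: [folklore] lattice bookkeeping; the junction with PART 26b's (E, ι, P, π, C, S) letters (S_{bq} := −[q in the curtain of b], C·S·C = C,
|S_{bq}| ≤ 1) and the kernel bound are the successor file's; nothing of Bałaban's asserted; NOT N5 for the model, NOT (3.36), NOT B12 Thm 2,
NOT BetaPertH, NOT continuum, NOT Clay.  HONEST DEPENDENCY: continuum YM on T⁴ ⇐ BetaPertH ∧ nine spine estimates (0/9 proved); BetaPertH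
⇐ (D1) ∧ (D4) ∧ CAP+tail; G-an2-4 gates asym, D1 and NE2/3/4.
-/

namespace Summit.QuantumFields.BalabanUV.Beta.EriceGaugeFormAxial

open scoped BigOperators
open Finset
open Literature.MathematicalPhysics.QuantumFieldTheory.Balaban1983to89.B7Prop1Explicit (e e_apply)
open Summit.QuantumFields.BalabanUV.Beta.EriceLatticePoincareBox (sum_Ico_int_telescope sum_Ico_int_succ)

variable {M : Type*} [AddCommGroup M] {d : ℕ}

/-! ## §1. The curtain identity -/

/-- **THE CURTAIN IDENTITY (complete axial gauge = curtain sum of the curvature).**  B any bond field on ℤ^d; p_k(x,t) the path point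
(`hp`); Λ the path potential of PART 23b (`hΛ`).  For every x with lo ≤ x and every direction μ:
B(x,μ) − (Λ(x+e_μ) − Λ(x)) = −Σ_k [μ < k]·Σ_{t∈[lo_k,x_k)} (B(p_k(x,t),μ) + B(p_k(x,t)+e_μ,k) − B(p_k(x,t)+e_k,μ) − B(p_k(x,t),k)) — the legs
k > μ of the paths to x and to x + e_μ differ by the shift e_μ; the difference of the two leg sums is the curl on the curtain between them plus
a telescoping boundary term. [folklore] -/
theorem sub_grad_potential_eq_neg_curtain (lo : Fin d → ℤ) (B : (Fin d → ℤ) → Fin d → M)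
    (p : ℕ → (Fin d → ℤ) → ℤ → (Fin d → ℤ))
    (hp : ∀ k x t i, p k x t i = if (i : ℕ) < k then x i else if (i : ℕ) = k then t else lo i)
    (Λ : (Fin d → ℤ) → M) (hΛ : ∀ x, Λ x = ∑ k : Fin d, ∑ t ∈ Finset.Ico (lo k) (x k), B (p k x t) k)
    (x : Fin d → ℤ) (μ : Fin d) (hlo : ∀ i, lo i ≤ x i) :
    B x μ - (Λ (x + e μ) - Λ x)
      = -∑ k : Fin d, if (μ : ℕ) < k then ∑ t ∈ Finset.Ico (lo k) (x k),
          (B (p k x t) μ + B (p k x t + e μ) k - B (p k x t + e k) μ - B (p k x t) k) else 0 := by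
  classical
  -- leg k: Σ_{lo k ≤ t < x k} B (p k x t) k
  let L : Fin d → (Fin d → ℤ) → M := fun k x => ∑ t ∈ Finset.Ico (lo k) (x k), B (p k x t) k
  have hΛL : ∀ y, Λ y = ∑ k, L k y := fun y => hΛ y
  -- geometry of the path points (as in PART 23b)
  have hp_lt : ∀ k : Fin d, (k : ℕ) < μ → ∀ t, p k (x + e μ) t = p k x t := by
    intro k hk t; funext i; simp only [hp, Pi.add_apply, e_apply]
    by_cases h1 : (i : ℕ) < k
    · have : i ≠ μ := by intro h; subst h; omega
      rw [if_pos h1, if_pos h1, if_neg this, add_zero]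
    · rw [if_neg h1, if_neg h1]
  have hx_lt : ∀ k : Fin d, (k : ℕ) < μ → (x + e μ) k = x k := by
    intro k hk; simp only [Pi.add_apply, e_apply]; rw [if_neg (by intro h; subst h; omega), add_zero]
  have hp_eq : ∀ t, p μ (x + e μ) t = p μ x t := by
    intro t; funext i; simp only [hp, Pi.add_apply, e_apply]
    by_cases h1 : (i : ℕ) < μ
    · have : i ≠ μ := by intro h; subst h; omega
      rw [if_pos h1, if_pos h1, if_neg this, add_zero]
    · rw [if_neg h1, if_neg h1]
  have hx_eq : (x + e μ) μ = x μ + 1 := by simp [e_apply]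
  have hp_gt : ∀ k : Fin d, (μ : ℕ) < k → ∀ t, p k (x + e μ) t = p k x t + e μ := by
    intro k hk t; funext i; simp only [hp, Pi.add_apply, e_apply]
    by_cases h1 : (i : ℕ) < k
    · rw [if_pos h1, if_pos h1]
    · rw [if_neg h1, if_neg h1]
      have : i ≠ μ := by intro h; subst h; omega
      rw [if_neg this, add_zero]
  have hx_gt : ∀ k : Fin d, (μ : ℕ) < k → (x + e μ) k = x k := by
    intro k hk; simp only [Pi.add_apply, e_apply]; rw [if_neg (by intro h; subst h; omega), add_zero]
  -- the corner points q k (coordinates below k from x, the rest from lo)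
  let q : ℕ → (Fin d → ℤ) := fun k i => if (i : ℕ) < k then x i else lo i
  have hp_lo : ∀ k : Fin d, p k x (lo k) = q k := by
    intro k; funext i; simp only [hp, q]
    by_cases h1 : (i : ℕ) < k
    · rw [if_pos h1, if_pos h1]
    · rw [if_neg h1, if_neg h1]
      by_cases h2 : (i : ℕ) = k
      · rw [if_pos h2]; have : i = k := Fin.ext h2; rw [this]
      · rw [if_neg h2]
  have hp_top : ∀ k : Fin d, p k x (x k) = q ((k : ℕ) + 1) := by
    intro k; funext i; simp only [hp, q]
    by_cases h1 : (i : ℕ) < k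
    · rw [if_pos h1, if_pos (Nat.lt_succ_of_lt h1)]
    · rw [if_neg h1]
      by_cases h2 : (i : ℕ) = k
      · rw [if_pos h2, if_pos (by omega)]; have : i = k := Fin.ext h2; rw [this]
      · rw [if_neg h2, if_neg (by omega)]
  have hp_step : ∀ (k : Fin d) (t : ℤ), p k x t + e k = p k x (t + 1) := by
    intro k t; funext i; simp only [hp, Pi.add_apply, e_apply]
    by_cases hik : i = k
    · subst hik; simp
    · have hne : (i : ℕ) ≠ k := fun h => hik (Fin.ext h)
      rw [if_neg hik, add_zero, if_neg hne, if_neg hne]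
  have hq_top : q d = x := by funext i; simp only [q]; rw [if_pos i.isLt]
  -- the curl, read as: B (z + e μ) k - B z k = (B (z + e k) μ - B z μ) + curl(z, μ, k)
  have hcz : ∀ (k : Fin d) (t : ℤ),
      B (p k x t + e μ) k - B (p k x t) k = (B (p k x t + e k) μ - B (p k x t) μ)
        + (B (p k x t) μ + B (p k x t + e μ) k - B (p k x t + e k) μ - B (p k x t) k) := by
    intro k t; abel
  -- the letters of the final telescoping
  let G : ℕ → M := fun k => B (q k) μ
  let W : Fin d → M := fun k => ∑ t ∈ Finset.Ico (lo k) (x k),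
    (B (p k x t) μ + B (p k x t + e μ) k - B (p k x t + e k) μ - B (p k x t) k)
  have hloμ : lo μ ≤ x μ := hlo μ
  have hD : ∀ k : Fin d, L k (x + e μ) - L k x =
      if (k : ℕ) < μ then (0 : M) else if (k : ℕ) = μ then G ((μ : ℕ) + 1) else G ((k : ℕ) + 1) - G k + W k := by
    intro k
    rcases Nat.lt_trichotomy (k : ℕ) μ with hk | hk | hk
    · rw [if_pos hk]; simp only [L]
      rw [hx_lt k hk, Finset.sum_congr rfl (fun t _ => by rw [hp_lt k hk t]), sub_self]
    · have hkμ : k = μ := Fin.ext hk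
      subst hkμ
      rw [if_neg (lt_irrefl _), if_pos rfl]; simp only [L, G]
      rw [hx_eq, Finset.sum_congr rfl (fun t _ => by rw [hp_eq t]), sum_Ico_int_succ _ hloμ, add_sub_cancel_left,
        hp_top]
    · rw [if_neg (by omega), if_neg (by omega)]; simp only [L, G, W]
      rw [hx_gt k hk, Finset.sum_congr rfl (fun t _ => by rw [hp_gt k hk t]), ← Finset.sum_sub_distrib,
        Finset.sum_congr rfl (fun t _ => by rw [hcz k t]), Finset.sum_add_distrib]
      congr 1
      -- telescoping over lo k ≤ t < x k
      rw [Finset.sum_congr rfl (fun t _ => by rw [hp_step])]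
      have hlen : x k = lo k + ((x k - lo k).toNat : ℕ) := by have := hlo k; omega
      rw [hlen, sum_Ico_int_telescope (fun t => B (p k x t) μ) (lo k), ← hlen, hp_top, hp_lo]
  -- assemble: Λ(x+e_μ) − Λ(x) = Σ_k (L k (x+e_μ) − L k x) = G d − W-sum = B x μ − Σ_{k>μ} W k
  have hμd : (μ : ℕ) + 1 ≤ d := μ.isLt
  have hdiff : Λ (x + e μ) - Λ x = B x μ + ∑ k : Fin d, if (μ : ℕ) < k then W k else 0 := by
    rw [hΛL, hΛL, ← Finset.sum_sub_distrib, Finset.sum_congr rfl (fun k _ => hD k)]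
    -- split off the W part
    have hsplit : ∀ k : Fin d, (if (k : ℕ) < μ then (0 : M) else
        if (k : ℕ) = μ then G ((μ : ℕ) + 1) else G ((k : ℕ) + 1) - G k + W k)
        = (if (k : ℕ) < μ then (0 : M) else if (k : ℕ) = μ then G ((μ : ℕ) + 1) else G ((k : ℕ) + 1) - G k)
          + (if (μ : ℕ) < k then W k else 0) := by
      intro k
      rcases Nat.lt_trichotomy (k : ℕ) μ with hk | hk | hk
      · rw [if_pos hk, if_pos hk, if_neg (by omega), add_zero]
      · rw [if_neg (by omega), if_pos hk, if_neg (by omega), if_pos hk, if_neg (by omega), add_zero]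
      · rw [if_neg (by omega), if_neg (by omega), if_neg (by omega), if_neg (by omega), if_pos hk]
    rw [Finset.sum_congr rfl (fun k _ => hsplit k), Finset.sum_add_distrib]
    congr 1
    rw [Fin.sum_univ_eq_sum_range (fun k => if k < (μ : ℕ) then (0 : M) else
        if k = (μ : ℕ) then G ((μ : ℕ) + 1) else G (k + 1) - G k) d,
      Finset.range_eq_Ico, ← Finset.sum_Ico_consecutive _ (Nat.zero_le _) hμd]
    have hhead : ∑ k ∈ Finset.Ico 0 ((μ : ℕ) + 1), (if k < (μ : ℕ) then (0 : M) else
        if k = (μ : ℕ) then G ((μ : ℕ) + 1) else G (k + 1) - G k) = G ((μ : ℕ) + 1) := by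
      rw [← Finset.range_eq_Ico, Finset.sum_range_succ, if_neg (lt_irrefl _), if_pos rfl,
        Finset.sum_eq_zero (fun k hk => by rw [if_pos (Finset.mem_range.mp hk)]), zero_add]
    have htail : ∑ k ∈ Finset.Ico ((μ : ℕ) + 1) d, (if k < (μ : ℕ) then (0 : M) else
        if k = (μ : ℕ) then G ((μ : ℕ) + 1) else G (k + 1) - G k) = G d - G ((μ : ℕ) + 1) := by
      rw [Finset.sum_congr rfl (fun k hk => by
        have hk' := (Finset.mem_Ico.mp hk).1
        rw [if_neg (by omega), if_neg (by omega)]), Finset.sum_Ico_eq_sum_range]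
      have ht := Finset.sum_range_sub (fun i => G ((μ : ℕ) + 1 + i)) (d - ((μ : ℕ) + 1))
      have e3 : (μ : ℕ) + 1 + (d - ((μ : ℕ) + 1)) = d := by omega
      simp only [e3, add_zero] at ht
      rw [← ht]
      exact Finset.sum_congr rfl fun i _ => by rw [add_assoc]
    rw [hhead, htail]
    simp only [G]
    rw [hq_top]
    abel
  rw [hdiff]
  simp only [W]
  abel

/-! ## §2. The curtain field is a section of the curl; its plaquettes lie in the box -/

/-- The curl of B − dΛ is the curl of B (any site function Λ). [folklore] -/
theorem curl_sub_grad (B : (Fin d → ℤ) → Fin d → M) (Λ : (Fin d → ℤ) → M) (A : (Fin d → ℤ) → Fin d → M)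
    (z : Fin d → ℤ) (μ ν : Fin d)
    (hA : ∀ κ, (κ = μ ∨ κ = ν) → ∀ y, (y = z ∨ y = z + e μ ∨ y = z + e ν) → A y κ = B y κ - (Λ (y + e κ) - Λ y)) :
    A z μ + A (z + e μ) ν - A (z + e ν) μ - A z ν = B z μ + B (z + e μ) ν - B (z + e ν) μ - B z ν := by
  rw [hA μ (Or.inl rfl) z (Or.inl rfl), hA ν (Or.inr rfl) (z + e μ) (Or.inr (Or.inl rfl)),
    hA μ (Or.inl rfl) (z + e ν) (Or.inr (Or.inr rfl)), hA ν (Or.inr rfl) z (Or.inl rfl), add_right_comm z (e μ) (e ν)]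
  abel

/-- **THE CURTAIN FIELD HAS THE CURL OF B** on every plaquette based at z ≥ lo: with A the curtain field of §1 (`hA`, written for ALL bonds
(y, κ) with lo ≤ y), curl A (z, μ, ν) = curl B (z, μ, ν) whenever lo ≤ z.  (A = B − dΛ_B there, and the curl kills gradients.) [folklore] -/
theorem curl_curtain_eq_curl (lo : Fin d → ℤ) (B : (Fin d → ℤ) → Fin d → M)
    (p : ℕ → (Fin d → ℤ) → ℤ → (Fin d → ℤ))
    (hp : ∀ k x t i, p k x t i = if (i : ℕ) < k then x i else if (i : ℕ) = k then t else lo i)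
    (A : (Fin d → ℤ) → Fin d → M)
    (hA : ∀ (y : Fin d → ℤ) (κ : Fin d), (∀ i, lo i ≤ y i) →
      A y κ = -∑ k : Fin d, if (κ : ℕ) < k then ∑ t ∈ Finset.Ico (lo k) (y k),
          (B (p k y t) κ + B (p k y t + e κ) k - B (p k y t + e k) κ - B (p k y t) k) else 0)
    (z : Fin d → ℤ) (μ ν : Fin d) (hlo : ∀ i, lo i ≤ z i) :
    A z μ + A (z + e μ) ν - A (z + e ν) μ - A z ν = B z μ + B (z + e μ) ν - B (z + e ν) μ - B z ν := by
  classical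
  -- the path potential
  let Λ : (Fin d → ℤ) → M := fun x => ∑ k : Fin d, ∑ t ∈ Finset.Ico (lo k) (x k), B (p k x t) k
  have hcurt : ∀ (y : Fin d → ℤ) (κ : Fin d), (∀ i, lo i ≤ y i) → A y κ = B y κ - (Λ (y + e κ) - Λ y) := by
    intro y κ hy
    rw [hA y κ hy, ← sub_grad_potential_eq_neg_curtain lo B p hp Λ (fun _ => rfl) y κ hy]
  have enn : ∀ κ i : Fin d, (0 : ℤ) ≤ e κ i := fun κ i => by rw [e_apply]; split_ifs <;> norm_num
  refine curl_sub_grad B Λ A z μ ν (fun κ _ y hy => hcurt y κ ?_)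
  intro i
  rcases hy with rfl | rfl | rfl
  · exact hlo i
  · have := hlo i; have := enn μ i; simp only [Pi.add_apply]; omega
  · have := hlo i; have := enn ν i; simp only [Pi.add_apply]; omega

/-- **The curtain of a box bond lies in the box**: for a bond (x, μ) of the box [lo, hi] (lo ≤ x, x + e_μ ≤ hi), every plaquette
(p_k(x,t), μ, k) with μ < k and lo_k ≤ t < x_k satisfies lo ≤ p_k(x,t) and p_k(x,t) + e_μ + e_k ≤ hi. [folklore] -/
theorem curtain_plaquette_mem_box (lo hi : Fin d → ℤ) (p : ℕ → (Fin d → ℤ) → ℤ → (Fin d → ℤ))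
    (hp : ∀ k x t i, p k x t i = if (i : ℕ) < k then x i else if (i : ℕ) = k then t else lo i)
    (x : Fin d → ℤ) (μ : Fin d) (hlo : ∀ i, lo i ≤ x i) (hhi : ∀ i, (x + e μ) i ≤ hi i)
    (k : Fin d) (hk : (μ : ℕ) < k) (t : ℤ) (ht : lo k ≤ t) (htx : t < x k) :
    (∀ i, lo i ≤ p k x t i) ∧ ∀ i, (p k x t + e μ + e k) i ≤ hi i := by
  have hhi' : ∀ i, x i ≤ hi i := fun i => by
    have := hhi i; simp only [Pi.add_apply, e_apply] at this; split_ifs at this <;> omega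
  refine ⟨fun i => ?_, fun i => ?_⟩
  · rw [hp]
    split_ifs with h1 h2
    · exact hlo i
    · have : i = k := Fin.ext h2
      subst this; exact ht
    · exact le_rfl
  · simp only [Pi.add_apply, hp, e_apply]
    have hlohi : lo i ≤ hi i := (hlo i).trans (hhi' i)
    by_cases hik : i = k
    · subst hik
      rw [if_neg (lt_irrefl _), if_pos rfl, if_pos rfl, if_neg (by intro h; subst h; omega)]
      have := hhi' i; omega
    · have hne : (i : ℕ) ≠ k := fun h => hik (Fin.ext h)
      rw [if_neg hik]
      by_cases hiμ : i = μ
      · rw [if_pos (show (i : ℕ) < k by rw [hiμ]; exact hk), if_pos hiμ]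
        have h1 := hhi i
        simp only [Pi.add_apply, e_apply, if_pos hiμ] at h1
        omega
      · rw [if_neg hiμ]
        split_ifs with h1
        · have := hhi' i; omega
        · omega

end Summit.QuantumFields.BalabanUV.Beta.EriceGaugeFormAxial
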